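import Summits.QuantumAdvantage.QuantumAdvantage.Theorems.WalkTwoStepFarLocalCriterion

/-!
# (G♯) local engine — toward `FarLocal p`, part 4: the discordance criteria for a far cut with split to the LEFT

Cell qa-qnc0, rung (G♯) = item stmt-QuantumAdvantage-23121 (planner qa-qnc0-p2 g24, ask P2-24b); prover qn-prover-3 g15.

Mirror image of `WalkTwoStepFarLocalCriterion.lean`: the SAME five-block input `blockInput uX k uY k' uZ = uX ++ corner k ++ (uY ++
corner k' ++ uZ)`, but now the split `s = a + 1` of the far cut sits at the FIRST corner and its position `g = a + 2 + (b + 1)` at the second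
one: `N(s) = |uX| + k`, `N(g) = |uX| + 1 + |uY| + k'`; the flip `φ` at `g` negates `k'`, the flip `ψ` at `s` negates `k`.  The two
sufficient conditions for `disc u ≠ disc (ψ u)` (`discBit_ne_left_main`, `discBit_ne_left_mirror`) follow from the four-point formula
exactly as in the right-hand case.  WHAT THIS IS NOT: no counting yet; separation NOT moved.
-/

namespace Summit.QuantumAdvantage.AdviceFreeQNC0.LocalEngine

open Finset Classical

section LeftCriteria

variable {p : ℕ} [Fact p.Prime] {a b d : ℕ}

/-- **Criterion 1 (main term)**, split to the left.  Inputs on which the far cut `g` (position `a + 2 + (b + 1)`, split `a + 1`,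
`α ≠ β`) FIRES, whose liveness flips under `φ`, and whose mirror term vanishes, have `disc u ≠ disc (ψ u)`. -/
theorem discBit_ne_left_main (c : ℕ) (S : TwoStep p (a + 2 + (b + 2 + d)))
    (g h₂ : Fin (a + 2 + (b + 2 + d) + 1)) (hg : g.val = a + 2 + (b + 1)) (hh₂ : h₂.val = a + 1)
    (hsplit : S.s g = h₂.val) (hαβ : S.α g ≠ S.β g)
    (uX : Fin a → Bool) (k : Bool) (uY : Fin b → Bool) (k' : Bool) (uZ : Fin d → Bool)
    (hfire : fireAt S g (((wt uX + 1 + (wt uY + 1 + wt uZ) : ℕ) : ZMod p)) (((wt uX + k.toNat : ℕ)) : ZMod p) = true)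
    (hlive : (c + (a + 2 + (b + 1)) + (wt uX + 1 + (wt uY + 1 + wt uZ)) + (wt uX + 1 + wt uY)) % 3 ≠ 1)
    (hmirror : ¬ (S.s h₂ = a + 2 + (b + 1) ∧
      fireAt S h₂ (((wt uX + 1 + (wt uY + 1 + wt uZ) : ℕ) : ZMod p)) (((wt uX + 1 + wt uY : ℕ)) : ZMod p)
        ≠ fireAt S h₂ (((wt uX + 1 + (wt uY + 1 + wt uZ) : ℕ) : ZMod p)) (((wt uX + 1 + wt uY + 1 : ℕ)) : ZMod p))) :
    discBit c S g.val (blockInput uX k uY k' uZ)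
      ≠ discBit c S g.val (cornerFlip (a + 2 + (b + 2 + d)) h₂.val (blockInput uX k uY k' uZ)) := by
  have hdist : g.val + 2 ≤ h₂.val ∨ h₂.val + 2 ≤ g.val := Or.inr (by omega)
  apply discBit_ne_of_main c S g h₂ hsplit hdist
  · -- the fire bit of `g` flips under `ψ` (which negates `k`)
    rw [y_eq_fireAt, y_eq_fireAt, hsplit, hh₂, cornerFlip_blockInput_pos, wtPrefix_blockInput_pos, wtPrefix_blockInput_pos,
      wt_blockInput, wt_blockInput, hfire]
    intro h
    have h1 := hfire
    have h2 := h.symm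
    unfold fireAt at h1 h2
    rw [decide_eq_true_eq] at h1 h2
    cases k with
    | false =>
      simp only [Bool.toNat_false, Bool.not_false, Bool.toNat_true, Nat.cast_add, Nat.cast_one, add_zero] at h1 h2
      exact not_fire_and_fire_succ hαβ h1 h2
    | true =>
      simp only [Bool.toNat_true, Bool.not_true, Bool.toNat_false, Nat.cast_add, Nat.cast_one, add_zero] at h1 h2
      exact not_fire_and_fire_succ hαβ h2 h1
  · -- the liveness of `g` flips under `φ` (which negates `k'`)
    rw [hg, walkExp, walkExp, cornerFlip_blockInput_split, wtPrefix_blockInput_split, wtPrefix_blockInput_split, wt_blockInput,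
      wt_blockInput]
    cases k' with
    | false =>
      simp only [Bool.toNat_false, Bool.not_false, Bool.toNat_true, add_zero]
      exact decide_mod_three_ne _ _ (by ring) (by omega)
    | true =>
      simp only [Bool.toNat_true, Bool.not_true, Bool.toNat_false, add_zero]
      exact (decide_mod_three_ne _ _ (by ring) (by omega)).symm
  · -- the mirror term vanishes
    rintro ⟨h1, h2, -⟩
    apply hmirror
    refine ⟨by rw [h1, hg], ?_⟩
    rw [y_eq_fireAt, y_eq_fireAt, h1, hg, cornerFlip_blockInput_split, wtPrefix_blockInput_split, wtPrefix_blockInput_split,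
      wt_blockInput, wt_blockInput] at h2
    cases k' with
    | false =>
      simpa only [Bool.toNat_false, Bool.not_false, Bool.toNat_true, add_zero, ← Nat.add_assoc] using h2
    | true =>
      simpa only [Bool.toNat_true, Bool.not_true, Bool.toNat_false, add_zero, ← Nat.add_assoc] using h2.symm

/-- **Criterion 2 (mirror term)**, split to the left.  Inputs on which the far cut `g` has its split count at `a₀ + 2` (so it fires
neither at `u` nor at `ψ u`), while the cut `h₂` at the split position has split `g`, flips its fire bit under `φ` and its liveness
under `ψ`, have `disc u ≠ disc (ψ u)`. -/
theorem discBit_ne_left_mirror (hp5 : 5 ≤ p) (c : ℕ) (S : TwoStep p (a + 2 + (b + 2 + d)))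
    (g h₂ : Fin (a + 2 + (b + 2 + d) + 1)) (hg : g.val = a + 2 + (b + 1)) (hh₂ : h₂.val = a + 1)
    (hsplit : S.s g = h₂.val) (hαβ : S.α g ≠ S.β g)
    (uX : Fin a → Bool) (k : Bool) (uY : Fin b → Bool) (k' : Bool) (uZ : Fin d → Bool)
    (hshift : (S.α g - S.β g) * (((wt uX + k.toNat : ℕ)) : ZMod p)
        + S.β g * (((wt uX + 1 + (wt uY + 1 + wt uZ) : ℕ) : ZMod p)) = S.r g + 2 * (S.α g - S.β g))
    (hm1 : S.s h₂ = a + 2 + (b + 1))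
    (hm2 : fireAt S h₂ (((wt uX + 1 + (wt uY + 1 + wt uZ) : ℕ) : ZMod p)) (((wt uX + 1 + wt uY : ℕ)) : ZMod p)
        ≠ fireAt S h₂ (((wt uX + 1 + (wt uY + 1 + wt uZ) : ℕ) : ZMod p)) (((wt uX + 1 + wt uY + 1 : ℕ)) : ZMod p))
    (hm3 : (c + (a + 1) + (wt uX + 1 + (wt uY + 1 + wt uZ)) + wt uX) % 3 ≠ 1) :
    discBit c S g.val (blockInput uX k uY k' uZ)
      ≠ discBit c S g.val (cornerFlip (a + 2 + (b + 2 + d)) h₂.val (blockInput uX k uY k' uZ)) := by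
  have hdist : g.val + 2 ≤ h₂.val ∨ h₂.val + 2 ≤ g.val := Or.inr (by omega)
  obtain ⟨hn0, hn1, hnm1⟩ := not_fire_of_shift_two hp5 hαβ hshift
  apply discBit_ne_of_mirror c S g h₂ hsplit hdist
  · -- `g` fires neither at `u` nor at `ψ u`
    rw [y_eq_fireAt, y_eq_fireAt, hsplit, hh₂, cornerFlip_blockInput_pos, wtPrefix_blockInput_pos, wtPrefix_blockInput_pos,
      wt_blockInput, wt_blockInput]
    unfold fireAt
    have e0 : decide (S.α g * (((wt uX + k.toNat : ℕ)) : ZMod p)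
        + S.β g * ((((wt uX + 1 + (wt uY + 1 + wt uZ) : ℕ) : ZMod p)) - (((wt uX + k.toNat : ℕ)) : ZMod p))
          = S.r g) = false := decide_eq_false hn0
    rw [e0]
    symm
    apply decide_eq_false
    cases k with
    | false =>
      have e : (((wt uX + (!false).toNat : ℕ)) : ZMod p) = (((wt uX + false.toNat : ℕ)) : ZMod p) + 1 := by
        simp only [Bool.not_false, Bool.toNat_true, Bool.toNat_false, add_zero]; push_cast; ring
      rw [e]; exact hn1
    | true =>
      apply hnm1
      simp only [Bool.not_true, Bool.toNat_false, Bool.toNat_true, add_zero]; push_cast; ring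
  · exact by rw [hm1, hg]
  · rw [y_eq_fireAt, y_eq_fireAt, hm1, hg, cornerFlip_blockInput_split, wtPrefix_blockInput_split, wtPrefix_blockInput_split,
      wt_blockInput, wt_blockInput]
    cases k' with
    | false => simpa only [Bool.toNat_false, Bool.not_false, Bool.toNat_true, add_zero, ← Nat.add_assoc] using hm2
    | true => simpa only [Bool.toNat_true, Bool.not_true, Bool.toNat_false, add_zero, ← Nat.add_assoc] using hm2.symm
  · rw [hh₂, walkExp, walkExp, cornerFlip_blockInput_pos, wtPrefix_blockInput_pos, wtPrefix_blockInput_pos, wt_blockInput,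
      wt_blockInput]
    cases k with
    | false =>
      simp only [Bool.toNat_false, Bool.not_false, Bool.toNat_true, add_zero]
      exact decide_mod_three_ne _ _ (by ring) (by omega)
    | true =>
      simp only [Bool.toNat_true, Bool.not_true, Bool.toNat_false, add_zero]
      exact (decide_mod_three_ne _ _ (by ring) (by omega)).symm

end LeftCriteria

end Summit.QuantumAdvantage.AdviceFreeQNC0.LocalEngine
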